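import Summits.QuantumFields.YangMills.Theorems.LuscherReductionTwistedTraceScalingBTColourFP
import Summits.QuantumFields.YangMills.Theorems.LuscherReductionTwistedTraceScalingBTPointwise
import HarnessLib

/-!
# (B-T) ⟸ a pointwise comparison of the colour-localised BO kernel `fpBOKernel` with the RAW one-site kernel
# (lane A of S-BASE, crux `TwistedTraceScaling` stmt-QuantumFields-20203, C4-CORE; design note `pub/ym-fleet/ym-luscher-20007-p1/COARSE-DESIGN.md` §25)

Sequel of `…BTColourFP` (Faddeev–Popov identity for the global colour action, `boKernel_fp`: `Z·𝒦_β(u,u') = ∫_c fpBOKernel(c⁻¹uc, u') dc`) and `…BTPointwise`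
(`hT_of_pointwise`: (B-T) ⟸ pointwise `𝒦 ≈ c·K̃₁`):
* ★★★ `boKernel_pointwise_of_fp` — a two-sided POINTWISE bound `|fpBOKernel(u,u') − C·K₁^{(B)}(u,u')| ≤ κ·C·K₁^{(B)}(u,u')` on the (conjugation-invariant) window
  `{orbitDist < δ}` gives `|𝒦_β(u,u') − (C/Z)·K̃₁^{(B)}(u,u')| ≤ κ·(C/Z)·K̃₁^{(B)}(u,u')` (`K₁` the RAW one-site kernel `transferKernel su2Rep B`, `K̃₁ = avgKernel B` its colour average,
  `avgKernel_one_eq_integral_conj`);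
* ★★★ `hT_of_fp` — the `∀ᶠ β` packaging: `RecordAnalyticInput.hT` with `σ β := C β / Z β / recordGamma L Ω β`.
So the OPEN content of (B-T) is now ONE pointwise Laplace statement about `fpBOKernel β Ω W` against `exp(L³β[Σ_k Re tr(u_k u'_k⁻¹) − ½(S₁(u)+S₁(u'))])` on the window, for the
frozen Gaussian `Ω` and the FP weight `W` of record (COARSE-DESIGN §25.3).
HONEST FRAMING: exact bookkeeping; the Laplace core of (B-T) is OPEN; C4-CORE OPEN; stub of a child of the CONDITIONAL route R2b1; not infinite volume, not a gap, not Clay.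
-/

set_option autoImplicit false

noncomputable section

open MeasureTheory Filter Topology Real
open scoped BigOperators
open Literature.MathematicalPhysics.QuantumFieldTheory
open Literature.MathematicalPhysics.QuantumLattice

namespace Summit.QuantumFields.YangMills.Theorems.FemtoTransferGap.TwoLattice.ConstTube

open Summit.QuantumFields.YangMills.Theorems.FemtoTransferGap
open Summit.QuantumFields.YangMills.Theorems.FemtoTransferGap.TwoLattice.Avg
open Summit.QuantumFields.YangMills.Theorems.FemtoTransferGap.TwoLattice.Stiff (LinkSpace)

variable {L : ℕ} [NeZero L]

/-- ★★★ **Pointwise `fpBOKernel ≈ C·K₁` on the window ⇒ pointwise `𝒦 ≈ (C/Z)·K̃₁` on the window.**  The window `{orbitDist < δ}` is conjugation invariant, the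
one-site averaged kernel is the colour integral of the raw one (`avgKernel_one_eq_integral_conj`), and `Z·𝒦 = ∫_c fpBOKernel(c⁻¹uc,u')` (`boKernel_fp`). [cite: Luscher1983, §3] -/
theorem boKernel_pointwise_of_fp (β B : ℝ) {Ω : LinkSpace L → ℝ} (hΩm : Measurable Ω) {CΩ : ℝ} (hCΩ : ∀ x, |Ω x| ≤ CΩ)
    (hΩinv : ∀ (g : SU2) (x : LinkSpace L), Ω (adL L g x) = Ω x)
    {W : (Site 3 L → SU2) → ℝ} (hW : Measurable W) {CW : ℝ} (hCW : ∀ g, |W g| ≤ CW) {Z : ℝ} (hZ0 : 0 < Z)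
    (hZ : ∀ g : Site 3 L → SU2, ∫ c, W (fun x => c * g x) ∂haarProbability SU2 = Z)
    {C κ δ : ℝ}
    (hpt : ∀ u u' : GaugeConfig 3 1 SU2, orbitDist u < δ → orbitDist u' < δ →
      |fpBOKernel L β Ω W u u' - C * transferKernel su2Rep B u u'| ≤ κ * C * transferKernel su2Rep B u u')
    (u u' : GaugeConfig 3 1 SU2) (hu : orbitDist u < δ) (hu' : orbitDist u' < δ) :
    |boKernel L β Ω u u' - C / Z * avgKernel B u u'| ≤ κ * (C / Z) * avgKernel B u u' := by
  haveI : SecondCountableTopology SU2 := secondCountableTopology_su2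
  obtain ⟨hint, hid⟩ := boKernel_fp (L := L) β hΩm hCΩ hΩinv hW hCW hZ u u'
  -- the colour integrand of the one-site averaged kernel
  have hK1m : Measurable fun c : SU2 => transferKernel su2Rep B (gaugeTransform (fun _ : Site 3 1 => c⁻¹) u) u' := by
    have h1 : Measurable fun c : SU2 => gaugeTransform (fun _ : Site 3 1 => c⁻¹) u := by
      have h := (measurable_constGaugeAction_left (L := 1) u).comp measurable_inv
      simpa only [Function.comp_def] using h
    have h2 : Measurable fun c : SU2 => (gaugeTransform (fun _ : Site 3 1 => c⁻¹) u, u') := h1.prodMk measurable_const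
    have h := (continuous_transferKernel su2Rep continuous_su2Rep B (L := 1)).measurable.comp h2
    simpa only [Function.comp_def] using h
  obtain ⟨M1, hM1⟩ := exists_transferKernel_le su2Rep continuous_su2Rep B (L := 1)
  have hK1int : Integrable (fun c : SU2 => transferKernel su2Rep B (gaugeTransform (fun _ : Site 3 1 => c⁻¹) u) u') (haarProbability SU2) :=
    integrable_of_measurable_abs_le _ hK1m (C := M1) fun c => by rw [abs_of_pos (transferKernel_pos su2Rep B _ _)]; exact hM1 _ _
  have hav := avgKernel_one_eq_integral_conj B u u'
  have hptc : ∀ c : SU2, |fpBOKernel L β Ω W (gaugeTransform (fun _ : Site 3 1 => c⁻¹) u) u' - C * transferKernel su2Rep B (gaugeTransform (fun _ : Site 3 1 => c⁻¹) u) u'| ≤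
      κ * C * transferKernel su2Rep B (gaugeTransform (fun _ : Site 3 1 => c⁻¹) u) u' := fun c =>
    hpt _ _ (by rw [orbitDist_gaugeTransform]; exact hu) hu'
  have hdiff : boKernel L β Ω u u' - C / Z * avgKernel B u u' =
      Z⁻¹ * ∫ c, (fpBOKernel L β Ω W (gaugeTransform (fun _ : Site 3 1 => c⁻¹) u) u' - C * transferKernel su2Rep B (gaugeTransform (fun _ : Site 3 1 => c⁻¹) u) u')
        ∂haarProbability SU2 := by
    rw [integral_sub hint (hK1int.const_mul C), integral_const_mul, ← hid, ← hav]
    field_simp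
  have hI : |∫ c, (fpBOKernel L β Ω W (gaugeTransform (fun _ : Site 3 1 => c⁻¹) u) u' - C * transferKernel su2Rep B (gaugeTransform (fun _ : Site 3 1 => c⁻¹) u) u')
      ∂haarProbability SU2| ≤ κ * C * avgKernel B u u' := by
    rw [hav]
    calc |∫ c, (fpBOKernel L β Ω W (gaugeTransform (fun _ : Site 3 1 => c⁻¹) u) u' - C * transferKernel su2Rep B (gaugeTransform (fun _ : Site 3 1 => c⁻¹) u) u') ∂haarProbability SU2|
        ≤ ∫ c, |fpBOKernel L β Ω W (gaugeTransform (fun _ : Site 3 1 => c⁻¹) u) u' - C * transferKernel su2Rep B (gaugeTransform (fun _ : Site 3 1 => c⁻¹) u) u'| ∂haarProbability SU2 :=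
          abs_integral_le_integral_abs
      _ ≤ ∫ c, κ * C * transferKernel su2Rep B (gaugeTransform (fun _ : Site 3 1 => c⁻¹) u) u' ∂haarProbability SU2 :=
          integral_mono_of_nonneg (ae_of_all _ fun _ => abs_nonneg _) (hK1int.const_mul _) (ae_of_all _ hptc)
      _ = κ * C * ∫ c, transferKernel su2Rep B (gaugeTransform (fun _ : Site 3 1 => c⁻¹) u) u' ∂haarProbability SU2 := integral_const_mul _ _
  rw [hdiff, abs_mul, abs_of_pos (inv_pos.mpr hZ0)]
  calc Z⁻¹ * |∫ c, (fpBOKernel L β Ω W (gaugeTransform (fun _ : Site 3 1 => c⁻¹) u) u' - C * transferKernel su2Rep B (gaugeTransform (fun _ : Site 3 1 => c⁻¹) u) u')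
        ∂haarProbability SU2| ≤ Z⁻¹ * (κ * C * avgKernel B u u') := mul_le_mul_of_nonneg_left hI (inv_pos.mpr hZ0).le
    _ = κ * (C / Z) * avgKernel B u u' := by field_simp

/-- ★★★ **(B-T) FROM THE COLOUR-LOCALISED POINTWISE COMPARISON** (the `∀ᶠ β` form of `RecordAnalyticInput.hT`, `σ β := C β / Z β / recordGamma L Ω β`): colour-blind measurable
`Ω β` with `|Ω| ≤ 1` and `recordGamma > 0`; FP weights `W β` (bounded measurable, colour-orbit integral `Z β > 0`); `C, κ ≥ 0`; and, eventually in `β`, the two-sided pointwise bound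
`|fpBOKernel β (Ω β) (W β) u u' − C β·K₁^{(L³β)}(u,u')| ≤ κ β·C β·K₁^{(L³β)}(u,u')` on the window `{orbitDist₁ < recordDelta1 L s β}`. [cite: Luscher1983, §3] -/
theorem hT_of_fp {s : ℝ} (hs : 0 < s) {Ω : ℝ → LinkSpace L → ℝ} (hΩm : ∀ β, Measurable (Ω β)) (hΩ1 : ∀ β x, |Ω β x| ≤ 1)
    (hΩinv : ∀ β (g : SU2) (x : LinkSpace L), Ω β (adL L g x) = Ω β x) (hγ : ∀ β, 0 < recordGamma L Ω β)
    {W : ℝ → (Site 3 L → SU2) → ℝ} (hW : ∀ β, Measurable (W β)) {CW : ℝ → ℝ} (hCW : ∀ β g, |W β g| ≤ CW β) {Z : ℝ → ℝ} (hZ0 : ∀ β, 0 < Z β)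
    (hZ : ∀ β (g : Site 3 L → SU2), ∫ c, W β (fun x => c * g x) ∂haarProbability SU2 = Z β)
    {C κ : ℝ → ℝ} (hC : ∀ β, 0 ≤ C β) (hκ : ∀ β, 0 ≤ κ β)
    (hpt : ∀ᶠ β : ℝ in atTop, ∀ u u' : GaugeConfig 3 1 SU2, orbitDist u < recordDelta1 L s β → orbitDist u' < recordDelta1 L s β →
      |fpBOKernel L β (Ω β) (W β) u u' - C β * transferKernel su2Rep ((L : ℝ) ^ 3 * β) u u'| ≤ κ β * C β * transferKernel su2Rep ((L : ℝ) ^ 3 * β) u u') :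
    ∀ᶠ β : ℝ in atTop, ∀ φ : GaugeConfig 3 1 SU2 → ℝ, Measurable φ → (∃ C : ℝ, ∀ u, |φ u| ≤ C) →
      (∀ (g : Site 3 1 → SU2) (u : GaugeConfig 3 1 SU2), φ (gaugeTransform g u) = φ u) → (∀ u, φ u ≠ 0 → orbitDist u < recordDelta1 L s β) →
      |tubeForm β (boFun L φ (Ω β)) - (C β / Z β / recordGamma L Ω β) * recordGamma L Ω β * qform su2Rep ((L : ℝ) ^ 3 * β) φ φ| ≤
        κ β * ((C β / Z β / recordGamma L Ω β) * recordGamma L Ω β) *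
          (qform su2Rep ((L : ℝ) ^ 3 * β) φ φ + levelValue su2Rep 1 ((L : ℝ) ^ 3 * β) 0 * l2 φ φ) := by
  have hpt' : ∀ᶠ β : ℝ in atTop, ∀ u u' : GaugeConfig 3 1 SU2, orbitDist u < recordDelta1 L s β → orbitDist u' < recordDelta1 L s β →
      |boKernel L β (Ω β) u u' - C β / Z β * avgKernel ((L : ℝ) ^ 3 * β) u u'| ≤ κ β * (C β / Z β) * avgKernel ((L : ℝ) ^ 3 * β) u u' := by
    filter_upwards [hpt] with β hβ u u' hu hu'
    exact boKernel_pointwise_of_fp β ((L : ℝ) ^ 3 * β) (hΩm β) (hΩ1 β) (hΩinv β) (hW β) (hCW β) (hZ0 β) (hZ β) hβ u u' hu hu'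
  exact hT_of_pointwise hs hΩm hΩ1 hγ (fun β => div_nonneg (hC β) (hZ0 β).le) hκ hpt'

end Summit.QuantumFields.YangMills.Theorems.FemtoTransferGap.TwoLattice.ConstTube

end
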